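import Summits.HodgeConjecture.HodgeCM.Model.ToyG2.BlockGram_1

/-! PORT of `HodgeCM/Model/ToyG2/BlockGram.lean` (HodgeCMPerL run 81) — part 2: continuation of `Summits.HodgeConjecture.HodgeCM.Model.ToyG2.BlockGram_1` (split at a top-level declaration boundary by port_pkg.py; scope re-opened below; declarations unchanged). -/

-- port_pkg: scope re-opened for this part (file-level context, then the namespace/section stack open at the cut)
noncomputable section
namespace HodgeCM.ToyG2
open Finset
namespace BlockData
variable {E : Type} [Fintype E] [DecidableEq E] (X : BlockData E)
/-- (Ported verbatim from the HodgeCMPerL package; no docstring in the source.) -/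
theorem C_fst_sec {k : Fin 3} {θ : E} (h : X.P k θ) : X.C (X.fst k θ) (X.sec k θ) = X.β k θ := by
  unfold C
  rw [Finset.sum_eq_single k]
  · rw [Finset.sum_eq_single θ]
    · simp [h, X.fst_ne_sec]
    · intro θ' _ hθ'
      have h1 : ¬ (X.fst k θ = X.fst k θ') := fun e => hθ' ((X.fst_inj.mp e).2.symm)
      simp [h1, X.fst_ne_sec]
    · simp
  · intro k' _ hk'
    refine Finset.sum_eq_zero fun θ' _ => ?_
    have h1 : ¬ (X.fst k θ = X.fst k' θ') := fun e => hk' ((X.fst_inj.mp e).1.symm)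
    simp [h1, X.fst_ne_sec]
  · simp

/-- (Ported verbatim from the HodgeCMPerL package; no docstring in the source.) -/
theorem C_sec_fst {k : Fin 3} {θ : E} (h : X.P k θ) : X.C (X.sec k θ) (X.fst k θ) = X.β k θ := by
  rw [X.C_symm]; exact X.C_fst_sec h

/-- `C u v = 0` unless `{u, v}` is a coupled pair of partners. -/
theorem C_eq_zero {u v : W E}
    (h : ∀ k θ, X.P k θ → ¬ (u = X.fst k θ ∧ v = X.sec k θ) ∧ ¬ (u = X.sec k θ ∧ v = X.fst k θ)) :
    X.C u v = 0 := by
  unfold C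
  refine Finset.sum_eq_zero fun k _ => Finset.sum_eq_zero fun θ _ => ?_
  by_cases hP : X.P k θ
  · simp [hP, (h k θ hP).1, (h k θ hP).2]
  · simp [hP]

/-! ### the kernel relation and non-vanishing -/

/-- (Ported verbatim from the HodgeCMPerL package; no docstring in the source.) -/
theorem g_fst_ne_zero {k : Fin 3} {θ : E} (h : X.P k θ) : X.g (X.fst k θ) ≠ 0 := by
  intro h0
  have := congrFun h0 (Sum.inr (k, θ))
  simp only [g, Sum.elim_inr, shared, h, if_true, X.fst_ne_sec, if_false, add_zero, Pi.zero_apply] at this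
  exact (Real.sqrt_pos.mpr (X.α_pos h)).ne' this

/-- **Kernel relation** on the couple `(0,1)/(2,3)`: the Gram vector of `u₀₁(ι) = sec 0 ι` is a multiple of that of
`u₂₃(ι) = fst 0 ι` (because `coef 0 = 1` makes the `2 × 2` block singular). -/
theorem g_sec_zero_eq_smul {ι : E} (h : X.P 0 ι) :
    X.g (X.sec 0 ι) = (X.β 0 ι / X.α 0 ι) • X.g (X.fst 0 ι) := by
  have hα := X.α_pos h
  have hsq : Real.sqrt (X.α 0 ι) ≠ 0 := (Real.sqrt_pos.mpr hα).ne'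
  have hρs : X.ρ (X.sec 0 ι) = 0 := by
    rw [X.ρ_sec h, X.β_zero_sq_eq, sub_eq_zero]
    field_simp
  have hρf : X.ρ (X.fst 0 ι) = 0 := X.ρ_fst h
  funext x
  rcases x with x | ⟨k, θ⟩
  · simp [g, hρs, hρf]
  · simp only [g, Sum.elim_inr, Pi.smul_apply, smul_eq_mul, shared]
    by_cases hP : X.P k θ
    · simp only [hP, if_true, X.sec_ne_fst, if_false, zero_add, X.fst_ne_sec, add_zero]
      by_cases hk : X.sec 0 ι = X.sec k θ
      · obtain ⟨rfl, rfl⟩ := X.sec_inj.mp hk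
        simp only [if_true]
        rw [div_mul_eq_mul_div, div_eq_div_iff hsq hα.ne', mul_assoc, Real.mul_self_sqrt hα.le]
      · have hk' : ¬ X.fst 0 ι = X.fst k θ := fun e => hk (by
          obtain ⟨h1, h2⟩ := X.fst_inj.mp e
          rw [h1, h2])
        simp [hk, hk']
    · simp [hP]

/-- (Ported verbatim from the HodgeCMPerL package; no docstring in the source.) -/
theorem β_zero_ne_zero {ι : E} (h : X.P 0 ι) : X.β 0 ι ≠ 0 := by
  intro h0
  have h1 := X.β_zero_sq_eq ι
  rw [h0] at h1
  have h2 : 0 < X.α 0 ι * X.D (X.sec 0 ι) := mul_pos (X.α_pos h) (X.D_pos h.2)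
  rw [← h1] at h2
  simp at h2

/-- The positive diagonal entry of `u₀₁(ι)`: `D (sec 0 ι) = s₀(ι) s₁(ι) > 0`. -/
theorem D_sec_zero (ι : E) : X.D (X.sec 0 ι) = X.s 0 ι * X.s 1 ι := by
  simp [D, sec, sh₁, sh₂, τ, coef]

end BlockData

end HodgeCM.ToyG2

end
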